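import Literature.Barriers.ResolutionOfSingularities.InseparableBaseChangeResolution
import HarnessLib

/-!
# Barrier: `Scheme.HasResolution` is not invariant under finite universal homeomorphisms — `Spec K` versus its Frobenius twist `Spec k[x]/((x − t)^p)` (perfect-closure-and-back blocked)

`Literature/Barriers/ResolutionOfSingularities/FrobeniusTwistResolution.lean` — barrier catalogue
entry (D-0021) for the summit `ResolutionOfSingularities`, companion of
`Literature.Barriers.ResolutionOfSingularities.InseparableBaseChangeResolution` (same witness,
different mechanism). For `k = 𝔽_p(t)`, `K = k(s)`, `s^p = t` (`baseField p`, `extField p`,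
`insepPoly p = x^p − t` of the parent entries), the FROBENIUS TWIST `K^{(p)} := K ⊗_{k, Frob} k` is
`k[x]/(x^p − t^p) = k[x]/((x − t)^p)`: base change of `AdjoinRoot (x^p − t)` along `Frob : k → k`
replaces the polynomial by its coefficientwise `p`-th power (`insepPoly_map_frobenius`). It is a
single non-reduced point, so it has NO resolution (`not_hasResolution_Spec_frobTwist`), while
`Spec K` is regular and is its own resolution; and the two are joined by finite universal
homeomorphisms in both directions — the relative Frobenius `F_{K/k} : Spec K → Spec K^{(p)}`
(ring map `x̄ ↦ s^p = t`, `exists_algHom_frobTwist_extField`) and the projection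
`Spec K^{(p)} → Spec K` (ring map `s ↦ x̄`, `c ↦ c^p` on `k`, `exists_ringHom_extField_frobTwist`).
Everything here is proved.

## What the sources print (verified on the page)

* Liu (2002), Example 3.2.12 / Prop. 3.2.7 (c): for `K/k` purely inseparable, "`X` is reduced but
  not geometrically reduced, because `X_K = Spec(K ⊗ₖ K)` is not reduced" and "the projection
  `X_K → X` is a homeomorphism". [cite: Liu2002, Example 3.2.12 and Prop. 3.2.7]
* Kollár (2007), 1.19: regularity over non-perfect `K = k(t)` is destroyed "after adjoining
  `t^{1/p}`". [cite: Kollar2007, 1.19 (Curves over nonperfect fields)]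

## Lean content (all proved)

`insepPoly_map_frobenius`; for the twist `T = AdjoinRoot ((X − C t)^p)`: `x̄ − t` is nilpotent and
non-zero, every element is a unit or nilpotent (`isUnit_or_isNilpotent_frobTwist`, via
`w = w(t) + (x − t)·(w /ₘ (x − t))`), `T` is not reduced, `Spec T` has no resolution
(parent lemma `not_hasResolution_Spec_of_isUnit_or_isNilpotent`); the two comparison maps exist;
headline `FrobeniusTwistResolution`.
-/

noncomputable section

open Polynomial AlgebraicGeometry
open Literature.AlgebraicGeometry.Resolution

namespace Literature.Barriers.ResolutionOfSingularities

section FrobeniusTwist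

variable (p : ℕ) [hp : Fact p.Prime]

/-- The twisted polynomial: applying Frobenius to the coefficients of `x^p − t` gives
`x^p − t^p = (x − t)^p`. [folklore] -/
theorem insepPoly_map_frobenius :
    (insepPoly p).map (frobenius (baseField p) p) = (X - C (RatFunc.X : baseField p)) ^ p := by
  simp only [Polynomial.map_sub, Polynomial.map_pow, Polynomial.map_X, Polynomial.map_C,
    frobenius_def]
  rw [sub_pow_char, ← C_pow]

/-- `x̄ − t` is nilpotent in the twist `k[x]/((x − t)^p)`. [folklore] -/
theorem isNilpotent_root_sub_frobTwist :
    IsNilpotent (AdjoinRoot.root ((X - C (RatFunc.X : baseField p)) ^ p) -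
      algebraMap (baseField p) (AdjoinRoot ((X - C (RatFunc.X : baseField p)) ^ p)) RatFunc.X) := by
  refine ⟨p, ?_⟩
  have : AdjoinRoot.mk ((X - C (RatFunc.X : baseField p)) ^ p) ((X - C RatFunc.X) ^ p) = 0 :=
    AdjoinRoot.mk_self
  rw [map_pow, map_sub, AdjoinRoot.mk_X, AdjoinRoot.mk_C] at this
  rw [AdjoinRoot.algebraMap_eq]
  exact this

/-- … and non-zero (`(x − t)^p ∤ (x − t)` because `p ≥ 2`). [folklore] -/
theorem root_sub_ne_zero_frobTwist :
    AdjoinRoot.root ((X - C (RatFunc.X : baseField p)) ^ p) -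
      algebraMap (baseField p) (AdjoinRoot ((X - C (RatFunc.X : baseField p)) ^ p)) RatFunc.X ≠ 0 := by
  rw [AdjoinRoot.algebraMap_eq, ← AdjoinRoot.mk_C, ← AdjoinRoot.mk_X, ← map_sub, Ne,
    AdjoinRoot.mk_eq_zero]
  intro h
  have hdeg := Polynomial.natDegree_le_of_dvd h (X_sub_C_ne_zero _)
  rw [natDegree_pow, natDegree_X_sub_C, mul_one] at hdeg
  exact absurd hdeg (not_le.mpr hp.out.one_lt)

/-- Every element of the twist is a unit or nilpotent: `w = w(t) + (x − t)·(w /ₘ (x − t))` with the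
second summand nilpotent. [folklore] -/
theorem isUnit_or_isNilpotent_frobTwist (z : AdjoinRoot ((X - C (RatFunc.X : baseField p)) ^ p)) :
    IsUnit z ∨ IsNilpotent z := by
  obtain ⟨w, rfl⟩ := AdjoinRoot.mk_surjective z
  have hdecomp : w = C (w.eval RatFunc.X) + (X - C RatFunc.X) * (w /ₘ (X - C RatFunc.X)) := by
    have h := Polynomial.modByMonic_add_div w (X - C (RatFunc.X : baseField p))
    rw [modByMonic_X_sub_C_eq_C_eval] at h
    exact h.symm
  have hnil : IsNilpotent (AdjoinRoot.mk ((X - C (RatFunc.X : baseField p)) ^ p)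
      ((X - C RatFunc.X) * (w /ₘ (X - C RatFunc.X)))) := by
    rw [map_mul, map_sub, AdjoinRoot.mk_X, AdjoinRoot.mk_C, ← AdjoinRoot.algebraMap_eq]
    exact Commute.isNilpotent_mul_right (Commute.all _ _) (isNilpotent_root_sub_frobTwist p)
  by_cases h0 : w.eval RatFunc.X = 0
  · right
    rw [hdecomp, h0, C_0, zero_add]
    exact hnil
  · left
    rw [hdecomp, map_add]
    refine IsNilpotent.isUnit_add_left_of_commute hnil ?_ (Commute.all _ _)
    rw [AdjoinRoot.mk_C]
    exact (isUnit_iff_ne_zero.mpr h0).map (AdjoinRoot.of _)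

/-- The twist is not reduced. [folklore] -/
theorem not_isReduced_frobTwist :
    ¬ _root_.IsReduced (AdjoinRoot ((X - C (RatFunc.X : baseField p)) ^ p)) := fun h =>
  root_sub_ne_zero_frobTwist p (h.eq_zero _ (isNilpotent_root_sub_frobTwist p))

/-- **The Frobenius twist `Spec k[x]/((x − t)^p)` of the regular point `Spec K` has no
resolution** (one non-reduced point). [cite: Liu2002, Example 3.2.12 and Prop. 3.2.7] -/
theorem not_hasResolution_Spec_frobTwist :
    ¬ Scheme.HasResolution (Spec (.of (AdjoinRoot ((X - C (RatFunc.X : baseField p)) ^ p)))) :=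
  not_hasResolution_Spec_of_isUnit_or_isNilpotent (isUnit_or_isNilpotent_frobTwist p)
    (not_isReduced_frobTwist p)

/-- The relative Frobenius `K^{(p)} → K`, `x̄ ↦ s^p = t`, exists as a `k`-algebra map (its `Spec`
is the finite universal homeomorphism `F_{K/k} : Spec K → Spec K^{(p)}`). [folklore] -/
theorem exists_algHom_frobTwist_extField :
    ∃ φ : AdjoinRoot ((X - C (RatFunc.X : baseField p)) ^ p) →ₐ[baseField p] extField p,
      φ (AdjoinRoot.root _) = algebraMap (baseField p) (extField p) RatFunc.X :=
  ⟨AdjoinRoot.liftAlgHom _ (Algebra.ofId _ _) (algebraMap (baseField p) (extField p) RatFunc.X)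
      (by simp [eval₂_pow, hp.out.ne_zero]),
    by simp⟩

/-- The projection `K → K^{(p)}`, `s ↦ x̄`, restricting to Frobenius `c ↦ c^p` on `k`, exists as a
ring map (its `Spec` is the base change `Spec K^{(p)} → Spec K` of `Frob : Spec k → Spec k`, a
universal homeomorphism). [folklore] -/
theorem exists_ringHom_extField_frobTwist :
    ∃ ψ : extField p →+* AdjoinRoot ((X - C (RatFunc.X : baseField p)) ^ p),
      ψ (AdjoinRoot.root (insepPoly p)) = AdjoinRoot.root _ ∧
        ∀ c : baseField p, ψ (algebraMap (baseField p) (extField p) c) =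
          algebraMap (baseField p) _ (c ^ p) := by
  refine ⟨AdjoinRoot.lift ((AdjoinRoot.of _).comp (frobenius (baseField p) p))
      (AdjoinRoot.root ((X - C (RatFunc.X : baseField p)) ^ p)) ?_, ?_, fun c => ?_⟩
  · rw [← Polynomial.eval₂_map, insepPoly_map_frobenius]
    exact AdjoinRoot.eval₂_root _
  · simp
  · rw [AdjoinRoot.algebraMap_eq, AdjoinRoot.lift_of, RingHom.comp_apply, frobenius_def,
      AdjoinRoot.algebraMap_eq]

end FrobeniusTwist

/-- **Barrier (Liu 2002, Example 3.2.12 / Prop. 3.2.7 (c), proved): `Scheme.HasResolution` is not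
invariant under finite universal homeomorphisms, in either direction.** For every prime `p` there
are a field `k` of characteristic `p` and `k`-algebras `K` (a field, finite purely inseparable
over `k`) and `T` (its Frobenius twist `K ⊗_{k,Frob} k = k[x]/((x − t)^p)`, `k = 𝔽_p(t)`,
`K = k(t^{1/p})`) with a `k`-algebra map `T → K` (relative Frobenius) and a ring map `K → T` over
the Frobenius of `k` (the projection), such that `Spec K` has a resolution and `Spec T` has none:
"`X_K = Spec(K ⊗ₖ K)` is not reduced" and "the projection `X_K → X` is a homeomorphism".
[cite: Liu2002, Example 3.2.12 and Prop. 3.2.7]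

Technique class, in prose: proving resolution over an imperfect field `k` (e.g. the perfect-to-all
descent `DescentPerfectToAll`, stmt-ResolutionOfSingularities-0549, or the radicial-bottom step of
route pAlteration, stmt-ResolutionOfSingularities-0556) by passing to the perfect closure
`k^{perf} ≅ ⋃ k^{1/pⁿ}`, resolving there, descending to a finite level `k^{1/pⁿ}` and "coming back"
through the abstract field isomorphism `k^{1/pⁿ} ≅ k` (a power of Frobenius): this produces a
resolution of the Frobenius TWIST `X^{(pⁿ)}`, which is joined to `X` only by finite universal
homeomorphisms (relative Frobenius / projection), and `HasResolution` does not pass along those;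
reducing the twist first (`(X^{(pⁿ)})_{red}`) destroys the comparison morphism to `X`. Formally:
`Scheme.HasResolution (Spec K) ∧ ¬ Scheme.HasResolution (Spec T)` with the two maps exhibited.

BARRIER (D-0021):
- technique_class: frobenius-twist perfect-closure-and-back universal-homeomorphism-transfer radicial-transfer-of-resolution frobenius-domination inseparable-base-change perfect-field-reduction
- blocks: (1) "resolve over the perfect closure and descend by Frobenius" as a proof of `DescentPerfectToAll` (stmt-ResolutionOfSingularities-0549): what descends is a resolution of a Frobenius twist of `X`, and `Spec K` (regular, its own resolution) has the twist `Spec k[x]/((x − t)^p)` with no resolution at all (`not_hasResolution_Spec_frobTwist`) — "`Spec(K ⊗ₖ K)` is not reduced", "the projection … is a homeomorphism" [cite: Liu2002, Example 3.2.12 and Prop. 3.2.7]; (2) any transfer principle "`Y → X` a finite universal homeomorphism (radicial, surjective) ⇒ (`HasResolution X ↔ HasResolution Y`)" for possibly non-reduced finite-type `k`-schemes, in either direction (`exists_algHom_frobTwist_extField`, `exists_ringHom_extField_frobTwist` give both directions between `Spec K` and `Spec T`); the printed Frobenius-domination argument for the radicial bottom (route pAlteration, stmt-0556) accordingly works only after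 reduction and for `X` normal, and regularity itself is lost under twisting: "after adjoining `t^{1/p}` … singular" [cite: Kollar2007, 1.19 (Curves over nonperfect fields)].
- because: twisting `AdjoinRoot (x^p − t)` along `Frob : k → k` raises coefficients to the `p`-th power, `x^p − t ↦ x^p − t^p = (x − t)^p` (`insepPoly_map_frobenius`, additivity of Frobenius), so the twist is `k[x]/((x − t)^p)`: every element is `w(t) + (x̄ − t)·w'`, a unit or nilpotent (`isUnit_or_isNilpotent_frobTwist`), one point, not reduced (`x̄ − t ≠ 0`, `(x̄ − t)^p = 0`); a one-point scheme with a resolution is reduced (parent entry, `isReduced_of_hasResolution_of_subsingleton`) [cite: Liu2002, Example 3.2.12 and Prop. 3.2.7].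
- evasions_known: (i) use the perfect closure only to produce purely inseparable regular ALTERATIONS (proper, surjective, generically finite radicial `Y' → X` with `Y'` regular), not resolutions — then the remaining step is the inseparable case of route pAlteration (`Picover`, `PicoverToRadicialBottom`); (ii) reduced twists of REDUCED `X` over a dense open are again reduced finite-type schemes, so the summit itself supplies their resolutions — the barrier constrains the transfer back to `X`, not their resolvability; (iii) over perfect `k` the twist is isomorphic to `X` and the phenomenon is absent.
- scope_caveats: (a) formal content = for every prime `p`, with `k = 𝔽_p(t)`, `K = k(t^{1/p})`, `T = k[x]/((x − t)^p)`: `(x^p − t)` maps to `(x − t)^p` under coefficientwise Frobenius; `T` is unit-or-nilpotent and not reduced; `Spec T` has no resolution, `Spec K` has one; a `k`-algebra map `T → K` with `x̄ ↦ t` and a ring map `K → T` with `s ↦ x̄`, `c ↦ c^p` exist; (b) NOT formalised: the identification `T ≅ K ⊗_{k,Frob} k` as the base change along Frobenius (stated via the polynomial identity only; Mathlib has no twisted-scalar tensor product at hand), that the two `Spec` maps are finite universal homeomorphisms (`AlgebraicGeometry.UniversallyInjective` etc. not invoked), and the general statement for arbitrary `X` and `n`; (c) nothing here bears on `DescentPerfectToAll`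 or the summit AS STATED; it constrains the perfect-closure mechanism; (d) for reduced `X` whose twists stay reduced (e.g. `X` geometrically reduced over `k`) the twist is abstractly `X ×ₖ k^{1/p}`, reduced, and the obstruction moves to regularity (`Literature.Barriers.ResolutionOfSingularities.RegularNotGeometricallyRegular`).
- status: established
-/
theorem FrobeniusTwistResolution (p : ℕ) [Fact p.Prime] :
    ∃ (k K T : Type) (_ : Field k) (_ : Field K) (_ : CommRing T) (_ : Algebra k K) (_ : Algebra k T)
      (_ : T →ₐ[k] K) (ψ : K →+* T), CharP k p ∧ FiniteDimensional k K ∧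
        (∀ c : k, ψ (algebraMap k K c) = algebraMap k T (c ^ p)) ∧
        Scheme.HasResolution (Spec (.of K)) ∧ ¬ Scheme.HasResolution (Spec (.of T)) := by
  obtain ⟨φ, -⟩ := exists_algHom_frobTwist_extField p
  obtain ⟨ψ, -, hψ⟩ := exists_ringHom_extField_frobTwist p
  exact ⟨baseField p, extField p, AdjoinRoot ((X - C (RatFunc.X : baseField p)) ^ p), inferInstance,
    inferInstance, inferInstance, inferInstance, inferInstance, φ, ψ, inferInstance, inferInstance,
    hψ, hasResolution_Spec_extField p, not_hasResolution_Spec_frobTwist p⟩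

end Literature.Barriers.ResolutionOfSingularities

end
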